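import Literature.AlgebraicGeometry.Motives.MixedHodgeStructureSubadditiveFunctions
import Literature.AlgebraicGeometry.Motives.MixedHodgeStructureHodgeClassesMultiplicity
import HarnessLib

/-!
# `Hom`-spaces into and out of a simple mixed Hodge structure: multiplicity formulas

Sequel to `MixedHodgeStructureSubadditiveFunctions` (`H ↦ dim_ℚ Hom_MHS(C, H)`, `H ↦ dim_ℚ Hom_MHS(H, C)` are
subadditive; `dim Hom_MHS(H, C) ≤ [H : C] · dim End_MHS(C)`) and `MixedHodgeStructureHodgeClassesMultiplicity` (the case
`C = ℚ(-p)` of maps INTO `H`: `dim Hdgᵖ(H) = dim Hom_MHS(ℚ(-p), H) = [soc H : ℚ(-p)]`). Auslander–Reiten–Smalø I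
THEOREM 1.2 and p. 9: the multiplicities `m_S(B)` of the simple composition factors are well defined, and "a semisimple
module of finite length is clearly uniquely determined by its composition factors", `B ≅ ∐_S m_S(B) S` for semisimple
`B`; with Schur's lemma (`Hom(S, S') = 0` for non-isomorphic simples, `End(S)` a division algebra; Cattani–El Zein–
Griffiths–Lê p. 270 for MHS) this gives the classical counting formulas `dim Hom(C, B) = m_C(B) · dim End(C) =
dim Hom(B, C)` for semisimple `B` and simple `C`. Jannsen, *Mixed Motives*, 7.8: `Hom` out of / into a fixed object is
only half exact on mixed realizations, exact on semisimple ones — so for a general `H` the formulas see the socle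
(maps in) and the top `H / rad H` (maps out). Krause, Lemma 13.1.5: `ℓ_{End E}(Hom(X, E)) ≤ ℓ(X)`. This file proves, for
mixed `ℚ`-Hodge structures and a SIMPLE `C` (`d_C := dim_ℚ End_MHS(C)`):

* §1 tools: `Hom` into `H` through a sub-MHS containing all images (`finrank_hom_left_eq_of_forall_range_le`), `Hom`
  out of `H` through a quotient killing a common kernel (`finrank_hom_right_eq_of_forall_le_ker`); **split extensions
  are `Γ`-exact**: `dim Hdgᵖ(E) = dim Hdgᵖ(B) + dim Hdgᵖ(A)` when `0 → B → E → A → 0` splits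
  (`Extension.finrank_hodgeClasses_eq_of_splitting`), hence **`dim Hom(C, S ⊕ T) = dim Hom(C, S) + dim Hom(C, T)`** and
  the same for `Hom(−, C)` (Krause's (SF1)).
* §2 simple against simple (Schur): `dim Hom(C, S) = [S : C] · d_C = dim Hom(S, C)`.
* §3 **semisimple `G`: `dim_ℚ Hom_MHS(C, G) = [G : C] · d_C = dim_ℚ Hom_MHS(G, C)`** (ARS: `G ≅ ∐ m_S(G) S`).
* §4 **arbitrary `H`: `dim_ℚ Hom_MHS(C, H) = [soc H : C] · d_C ≤ [H : C] · d_C`** (maps from a simple land in the socle)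
  and **`dim_ℚ Hom_MHS(H, C) = [H/rad H : C] · d_C ≤ [H : C] · d_C`** (maps to a simple kill the radical).
* §5 `C = ℚ(-p)` (`d_C = 1`): the **co-Hodge classes `Hom_MHS(H, ℚ(-p))` have dimension `[H/rad H : ℚ(-p)]`**
  (`finrank_hom_tate_eq_multiplicity_radical_quotient`), `≤ [H : ℚ(-p)]` with equality for semisimple `H` — the dual
  of `dim Hdgᵖ(H) = [soc H : ℚ(-p)]` (`MixedHodgeStructureHodgeClassesMultiplicity`), which is recovered here as
  `dim Hom_MHS(ℚ(-p), H) = [soc H : ℚ(-p)]`.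

All statements proved; no definitions, no named facts, no instances.

## References

* [AuslanderReitenSmalo1995] M. Auslander, I. Reiten, S. O. Smalø, Representation Theory of Artin Algebras (1995),
  I Thm. 1.2 and p. 9 (`m_S(B)`, semisimple modules determined by composition factors) (galaxy panama:223278169849861,
  chunk p0051).
* [Krause2021] H. Krause, Homological Theory of Representations (2021), §13.1 (SF1), Lemma 13.1.5.
* [Jannsen1990MixedMotives] U. Jannsen, Mixed Motives and Algebraic K-Theory, LNM 1400 (1990), 7.8 a), b) (p. 94).
* [CattaniElZeinGriffithsLe2014] E. Cattani et al. (eds.), Hodge Theory (2014), Thm. 3.2.18, Lemma 3.2.20, p. 270.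
* [DeligneHodgeII1971] P. Deligne, Théorie de Hodge II, 1.1.12, 2.1.11.1.
-/

noncomputable section

namespace Literature.AlgebraicGeometry.Motives

namespace MixedHodgeStructure

open Module SubMixedHodgeStructure

universe u v w uc

/-! ### §1 Tools: factoring `Hom`-spaces; split extensions are `Γ`-exact -/

section Tools

variable {V : Type u} [AddCommGroup V] [Module ℚ V] [FiniteDimensional ℚ V] {H : MixedHodgeStructure V}
variable {VC : Type uc} [AddCommGroup VC] [Module ℚ VC] [FiniteDimensional ℚ VC]

/-- **If every morphism `C → H` lands in the sub-MHS `S`, then `dim Hom_MHS(C, H) = dim Hom_MHS(C, S)`**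
(`Hom(C, S) → Hom(C, H)`, `φ ↦ ι_S ∘ φ`, is injective with image all of `Hom(C, H)`).
[cite: CattaniElZeinGriffithsLe2014, Lemma 3.2.20] [cite: DeligneHodgeII1971, 1.1.12] -/
theorem finrank_hom_left_eq_of_forall_range_le (C : MixedHodgeStructure VC) (S : SubMixedHodgeStructure H)
    (h : ∀ f : Hom C H, LinearMap.range f.toLinearMap ≤ S.toSubmodule) :
    finrank ℚ ((hom C H).hodgeClasses 0) = finrank ℚ ((hom C S.toMixedHodgeStructure).hodgeClasses 0) := by
  let Φ : Hom (hom C S.toMixedHodgeStructure) (hom C H) := Hom.homMap (Hom.id C) S.subtype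
  have hΦ : ∀ φ : VC →ₗ[ℚ] S.toSubmodule, Φ.toLinearMap φ = S.toSubmodule.subtype ∘ₗ φ := fun φ => by
    rw [Hom.homMap_toLinearMap_apply, Hom.id_toLinearMap, LinearMap.comp_id]; rfl
  have hinj : Function.Injective Φ.toLinearMap := by
    intro φ ψ hφψ
    rw [hΦ, hΦ] at hφψ
    exact LinearMap.ext fun c => Subtype.ext (LinearMap.congr_fun hφψ c)
  have hmap : ((hom C S.toMixedHodgeStructure).hodgeClasses 0).map Φ.toLinearMap = (hom C H).hodgeClasses 0 := by
    refine le_antisymm (Φ.map_hodgeClasses_le 0) fun f hf => ?_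
    let f' : Hom C H := (homEquivHodgeClasses C H).symm ⟨f, hf⟩
    have hf' : f'.toLinearMap = f := by
      have hc := coe_homEquivHodgeClasses_apply C H f'
      rwa [Equiv.apply_symm_apply] at hc
    let f'' : Hom C S.toMixedHodgeStructure := codRestrict S f' fun x => h f' (LinearMap.mem_range_self _ x)
    refine ⟨f''.toLinearMap, (homEquivHodgeClasses C S.toMixedHodgeStructure f'').2, ?_⟩
    rw [hΦ, ← hf']
    exact congrArg Hom.toLinearMap (subtype_comp_codRestrict S f' fun x => h f' (LinearMap.mem_range_self _ x))
  rw [← hmap]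
  exact (LinearEquiv.finrank_eq (Submodule.equivMapOfInjective Φ.toLinearMap hinj _)).symm

/-- **If every morphism `H → C` kills the sub-MHS `R`, then `dim Hom_MHS(H, C) = dim Hom_MHS(H/R, C)`**
(`Hom(H/R, C) → Hom(H, C)`, `ψ ↦ ψ ∘ π`, is injective with image all of `Hom(H, C)`).
[cite: CattaniElZeinGriffithsLe2014, Lemma 3.2.20] [cite: DeligneHodgeII1971, 1.1.12] -/
theorem finrank_hom_right_eq_of_forall_le_ker (C : MixedHodgeStructure VC) (R : SubMixedHodgeStructure H)
    (h : ∀ f : Hom H C, R.toSubmodule ≤ LinearMap.ker f.toLinearMap) :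
    finrank ℚ ((hom H C).hodgeClasses 0) = finrank ℚ ((hom R.quotient C).hodgeClasses 0) := by
  let Φ : Hom (hom R.quotient C) (hom H C) := Hom.homMap R.mkQ (Hom.id C)
  have hΦ : ∀ ψ : (V ⧸ R.toSubmodule) →ₗ[ℚ] VC, Φ.toLinearMap ψ = ψ ∘ₗ R.toSubmodule.mkQ := fun ψ => by
    rw [Hom.homMap_toLinearMap_apply, Hom.id_toLinearMap, LinearMap.id_comp]; rfl
  have hinj : Function.Injective Φ.toLinearMap := by
    intro φ ψ hφψ
    rw [hΦ, hΦ] at hφψ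
    exact LinearMap.ext fun x => by
      obtain ⟨v, rfl⟩ := Submodule.mkQ_surjective R.toSubmodule x
      exact LinearMap.congr_fun hφψ v
  have hmap : ((hom R.quotient C).hodgeClasses 0).map Φ.toLinearMap = (hom H C).hodgeClasses 0 := by
    refine le_antisymm (Φ.map_hodgeClasses_le 0) fun f hf => ?_
    let f' : Hom H C := (homEquivHodgeClasses H C).symm ⟨f, hf⟩
    have hf' : f'.toLinearMap = f := by
      have hc := coe_homEquivHodgeClasses_apply H C f'
      rwa [Equiv.apply_symm_apply] at hc
    let f'' : Hom R.quotient C := quotientLift R f' (h f')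
    refine ⟨f''.toLinearMap, (homEquivHodgeClasses R.quotient C f'').2, ?_⟩
    rw [hΦ, ← hf']
    exact congrArg Hom.toLinearMap (quotientLift_comp_mkQ R f' (h f'))
  rw [← hmap]
  exact (LinearEquiv.finrank_eq (Submodule.equivMapOfInjective Φ.toLinearMap hinj _)).symm

end Tools

section Split

variable {VA : Type v} [AddCommGroup VA] [Module ℚ VA] [FiniteDimensional ℚ VA]
variable {VB : Type w} [AddCommGroup VB] [Module ℚ VB] [FiniteDimensional ℚ VB]
variable {VE : Type uc} [AddCommGroup VE] [Module ℚ VE] [FiniteDimensional ℚ VE]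
variable {A : MixedHodgeStructure VA} {B : MixedHodgeStructure VB}

omit [FiniteDimensional ℚ VA] in
/-- **Split extensions are `Γ`-exact: `dim Hdgᵖ(E) = dim Hdgᵖ(B) + dim Hdgᵖ(A)` when `0 → B → E → A → 0` admits a
section** (Hodge classes of `A` lift along the section; those of `E` lying in `B` are Hodge classes of `B`).
[cite: Jannsen1990MixedMotives, 7.8 a) (p. 94)] [cite: CattaniElZeinGriffithsLe2014, Thm. 3.2.18] -/
theorem Extension.finrank_hodgeClasses_eq_of_splitting (E : Extension A B VE) (σ : E.Splitting) (p : ℤ) :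
    finrank ℚ (E.mhs.hodgeClasses p) = finrank ℚ (B.hodgeClasses p) + finrank ℚ (A.hodgeClasses p) := by
  let g : E.mhs.hodgeClasses p →ₗ[ℚ] VA := E.proj.toLinearMap.domRestrict (E.mhs.hodgeClasses p)
  have hrn := g.finrank_range_add_finrank_ker
  have hrange : LinearMap.range g = A.hodgeClasses p := by
    rw [LinearMap.range_domRestrict]
    exact E.proj.map_hodgeClasses_eq_of_section σ.sec (Hom.ext σ.proj_comp) p
  have hker : (LinearMap.ker g).map (E.mhs.hodgeClasses p).subtype = (B.hodgeClasses p).map E.inc.toLinearMap := by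
    rw [E.inc.map_hodgeClasses_eq_inf_range_of_injective E.injective_inc p]
    refine le_antisymm ?_ ?_
    · rintro _ ⟨x, hx, rfl⟩
      have hx' : E.proj.toLinearMap (x : VE) = 0 := hx
      exact ⟨x.2, (E.exact _).1 hx'⟩
    · rintro y ⟨hy, hy'⟩
      refine ⟨⟨y, hy⟩, ?_, rfl⟩
      show E.proj.toLinearMap y = 0
      exact (E.exact _).2 hy'
  have h2 : finrank ℚ (LinearMap.ker g) = finrank ℚ (B.hodgeClasses p) := by
    rw [← Submodule.finrank_map_subtype_eq (E.mhs.hodgeClasses p) (LinearMap.ker g), hker]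
    exact LinearEquiv.finrank_eq (Submodule.equivMapOfInjective _ E.injective_inc _).symm
  rw [hrange, h2] at hrn
  omega

end Split

section Additivity

variable {V : Type u} [AddCommGroup V] [Module ℚ V] [FiniteDimensional ℚ V] {H : MixedHodgeStructure V}
variable {VC : Type uc} [AddCommGroup VC] [Module ℚ VC] [FiniteDimensional ℚ VC]

/-- **(SF1) for `Hom(C, −)`: `dim Hom_MHS(C, S ⊕ T) = dim Hom_MHS(C, S) + dim Hom_MHS(C, T)`** for complementary
sub-MHS `S ⊕ T = H` (`0 → Hom(C, S) → Hom(C, H) → Hom(C, H/S) → 0` splits, `H/S ≅ T`).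
[cite: Krause2021, §13.1 (SF1)] [cite: DeligneHodgeII1971, 1.1.12] -/
theorem finrank_hom_left_eq_add_of_isCompl (C : MixedHodgeStructure VC) (S T : SubMixedHodgeStructure H)
    (hST : IsCompl S.toSubmodule T.toSubmodule) :
    finrank ℚ ((hom C H).hodgeClasses 0) =
      finrank ℚ ((hom C S.toMixedHodgeStructure).hodgeClasses 0) + finrank ℚ ((hom C T.toMixedHodgeStructure).hodgeClasses 0) := by
  let σ := S.splittingOfIsCompl T hST
  let σ' : (S.extension.homLeft C).Splitting :=
    { sec := Hom.homMap (Hom.id C) σ.sec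
      proj_comp := by
        refine LinearMap.ext fun φ => ?_
        rw [LinearMap.comp_apply, LinearMap.id_apply, Extension.homLeft_proj, Hom.homMap_toLinearMap_apply,
          Hom.homMap_toLinearMap_apply, Hom.id_toLinearMap, LinearMap.comp_id, LinearMap.comp_id,
          ← LinearMap.comp_assoc, σ.proj_comp, LinearMap.id_comp] }
  have h := (S.extension.homLeft C).finrank_hodgeClasses_eq_of_splitting σ' 0
  rw [Extension.homLeft_mhs, SubMixedHodgeStructure.extension_mhs] at h
  rw [h, (isSubadditive_finrank_hom_left C).iso _ (S.bijective_mkQ_comp_subtype T hST)]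

/-- **(SF1) for `Hom(−, C)`: `dim Hom_MHS(S ⊕ T, C) = dim Hom_MHS(S, C) + dim Hom_MHS(T, C)`.**
[cite: Krause2021, §13.1 (SF1)] [cite: DeligneHodgeII1971, 1.1.12] -/
theorem finrank_hom_right_eq_add_of_isCompl (C : MixedHodgeStructure VC) (S T : SubMixedHodgeStructure H)
    (hST : IsCompl S.toSubmodule T.toSubmodule) :
    finrank ℚ ((hom H C).hodgeClasses 0) =
      finrank ℚ ((hom S.toMixedHodgeStructure C).hodgeClasses 0) + finrank ℚ ((hom T.toMixedHodgeStructure C).hodgeClasses 0) := by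
  -- the retraction `r : H → S` along `T` gives the section `φ ↦ φ ∘ r` of `Hom(H, C) → Hom(S, C)`
  let r : Hom H S.toMixedHodgeStructure := projOfIsCompl T S hST.symm
  have hr : r.toLinearMap ∘ₗ S.toSubmodule.subtype = LinearMap.id :=
    LinearMap.ext fun s => projOfIsCompl_apply_of_mem_right T S hST.symm s
  let σ' : (S.extension.homRight C).Splitting :=
    { sec := Hom.homMap r (Hom.id C)
      proj_comp := by
        refine LinearMap.ext fun φ => ?_
        rw [LinearMap.comp_apply, LinearMap.id_apply, Extension.homRight_proj, Hom.homMap_toLinearMap_apply,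
          Hom.homMap_toLinearMap_apply, Hom.id_toLinearMap, LinearMap.id_comp, LinearMap.id_comp,
          LinearMap.comp_assoc, SubMixedHodgeStructure.extension_inc]
        change φ ∘ₗ (r.toLinearMap ∘ₗ S.toSubmodule.subtype) = φ
        rw [hr, LinearMap.comp_id] }
  have h := (S.extension.homRight C).finrank_hodgeClasses_eq_of_splitting σ' 0
  rw [Extension.homRight_mhs, SubMixedHodgeStructure.extension_mhs] at h
  rw [h, ← (isSubadditive_finrank_hom_right C).iso _ (S.bijective_mkQ_comp_subtype T hST), add_comm]

end Additivity

/-! ### §2 Simple against simple (Schur) -/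

section Simple

variable {V : Type u} [AddCommGroup V] [Module ℚ V] [FiniteDimensional ℚ V] {S : MixedHodgeStructure V}
variable {VC : Type uc} [AddCommGroup VC] [Module ℚ VC] [FiniteDimensional ℚ VC] {C : MixedHodgeStructure VC}

/-- **`dim Hom_MHS(C, S) = [S : C] · dim End_MHS(C)` for simple `S`, `C`** (`= dim End(C)` if `S ≅ C`, else `0`).
[cite: CattaniElZeinGriffithsLe2014, p. 270 (Schur)] [cite: AuslanderReitenSmalo1995, I Thm. 1.2] -/
theorem IsSimple.finrank_hom_left_eq_multiplicity_mul (hS : S.IsSimple) (hC : C.IsSimple) :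
    finrank ℚ ((hom C S).hodgeClasses 0) = S.multiplicity C * finrank ℚ ((hom C C).hodgeClasses 0) := by
  classical
  rw [hS.multiplicity_eq]
  split_ifs with he
  · obtain ⟨e, he⟩ := he
    rw [one_mul]
    exact finrank_hodgeClasses_eq_of_bijective (Hom.homMap (Hom.id C) e)
      (Hom.homMap_bijective _ _ Function.bijective_id he) 0
  · rw [zero_mul]
    refine forall_hom_eq_zero_iff_finrank_eq_zero.1 fun g => ?_
    rcases hC.bijective_or_eq_zero hS g with hg | hg
    · exact absurd ⟨g.inverse hg, by rw [Hom.inverse_toLinearMap]; exact (LinearEquiv.ofBijective _ hg).symm.bijective⟩ he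
    · exact hg

/-- **`dim Hom_MHS(S, C) = [S : C] · dim End_MHS(C)` for simple `S`, `C`.** [cite: CattaniElZeinGriffithsLe2014, p. 270 (Schur)]
[cite: AuslanderReitenSmalo1995, I Thm. 1.2] -/
theorem IsSimple.finrank_hom_right_eq_multiplicity_mul (hS : S.IsSimple) (hC : C.IsSimple) :
    finrank ℚ ((hom S C).hodgeClasses 0) = S.multiplicity C * finrank ℚ ((hom C C).hodgeClasses 0) := by
  classical
  rw [hS.multiplicity_eq]
  split_ifs with he
  · obtain ⟨e, he⟩ := he
    rw [one_mul]
    exact finrank_hodgeClasses_eq_of_bijective (Hom.homMap (e.inverse he) (Hom.id C))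
      (Hom.homMap_bijective _ _ (by rw [Hom.inverse_toLinearMap]; exact (LinearEquiv.ofBijective _ he).symm.bijective)
        Function.bijective_id) 0
  · rw [zero_mul]
    refine forall_hom_eq_zero_iff_finrank_eq_zero.1 fun g => ?_
    rcases hS.bijective_or_eq_zero hC g with hg | hg
    · exact absurd ⟨g, hg⟩ he
    · exact hg

end Simple

/-! ### §3 Semisimple `G`: `dim Hom(C, G) = [G : C] · d_C = dim Hom(G, C)` -/

section Semisimple

variable {VC : Type uc} [AddCommGroup VC] [Module ℚ VC] [FiniteDimensional ℚ VC] {C : MixedHodgeStructure VC}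

/-- The induction on `dim V` behind the semisimple formulas. [cite: AuslanderReitenSmalo1995, I Thm. 1.2 and p. 9] -/
private theorem finrank_hom_semisimple_aux (hC : C.IsSimple) (d : ℕ) : ∀ {W : Type u} [AddCommGroup W] [Module ℚ W]
    [FiniteDimensional ℚ W] (K : MixedHodgeStructure W), finrank ℚ W ≤ d → K.IsSemisimple →
    finrank ℚ ((hom C K).hodgeClasses 0) = K.multiplicity C * finrank ℚ ((hom C C).hodgeClasses 0) ∧
      finrank ℚ ((hom K C).hodgeClasses 0) = K.multiplicity C * finrank ℚ ((hom C C).hodgeClasses 0) := by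
  induction d with
  | zero =>
    intro W _ _ _ K hd _
    haveI : Subsingleton W := finrank_zero_iff.1 (Nat.le_zero.1 hd)
    rw [multiplicity_eq_zero_of_subsingleton, zero_mul]
    exact ⟨(isSubadditive_finrank_hom_left C).zero K, (isSubadditive_finrank_hom_right C).zero K⟩
  | succ d ih =>
    intro W _ _ _ K hd hK
    by_cases hW : Subsingleton W
    · exact ih K (by rw [finrank_zero_of_subsingleton]; exact Nat.zero_le _) hK
    rw [not_subsingleton_iff_nontrivial] at hW
    obtain ⟨S₀, hS₀⟩ := K.exists_subMixedHodgeStructure_isSimple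
    obtain ⟨T, hT⟩ := hK S₀
    haveI := hS₀.nontrivial
    have hdim : finrank ℚ T.toSubmodule ≤ d := by
      have h1 := Submodule.finrank_add_eq_of_isCompl hT
      have h2 : 0 < finrank ℚ S₀.toSubmodule := finrank_pos
      omega
    obtain ⟨ihl, ihr⟩ := ih T.toMixedHodgeStructure hdim (hK.subMixedHodgeStructure T)
    rw [finrank_hom_left_eq_add_of_isCompl C S₀ T hT, finrank_hom_right_eq_add_of_isCompl C S₀ T hT,
      multiplicity_eq_add_of_isCompl S₀ T hT, hS₀.finrank_hom_left_eq_multiplicity_mul hC,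
      hS₀.finrank_hom_right_eq_multiplicity_mul hC, ihl, ihr, add_mul]
    exact ⟨rfl, rfl⟩

variable {V : Type u} [AddCommGroup V] [Module ℚ V] [FiniteDimensional ℚ V] {H : MixedHodgeStructure V}

/-- **For a semisimple `G` and a simple `C`: `dim_ℚ Hom_MHS(C, G) = [G : C] · dim_ℚ End_MHS(C)`** (`G ≅ ∐_S m_S(G)·S`,
Schur). [cite: AuslanderReitenSmalo1995, I Thm. 1.2 and p. 9] [cite: Jannsen1990MixedMotives, 7.8 b) (p. 94)] -/
theorem IsSemisimple.finrank_hom_left_eq_multiplicity_mul (hH : H.IsSemisimple) (hC : C.IsSimple) :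
    finrank ℚ ((MixedHodgeStructure.hom C H).hodgeClasses 0) = H.multiplicity C * finrank ℚ ((MixedHodgeStructure.hom C C).hodgeClasses 0) :=
  (finrank_hom_semisimple_aux hC (finrank ℚ V) H le_rfl hH).1

/-- **For a semisimple `G` and a simple `C`: `dim_ℚ Hom_MHS(G, C) = [G : C] · dim_ℚ End_MHS(C)`.**
[cite: AuslanderReitenSmalo1995, I Thm. 1.2 and p. 9] [cite: Jannsen1990MixedMotives, 7.8 b) (p. 94)] -/
theorem IsSemisimple.finrank_hom_right_eq_multiplicity_mul (hH : H.IsSemisimple) (hC : C.IsSimple) :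
    finrank ℚ ((MixedHodgeStructure.hom H C).hodgeClasses 0) = H.multiplicity C * finrank ℚ ((MixedHodgeStructure.hom C C).hodgeClasses 0) :=
  (finrank_hom_semisimple_aux hC (finrank ℚ V) H le_rfl hH).2

/-- For a semisimple `G`, `dim Hom_MHS(C, G) = dim Hom_MHS(G, C)` (`C` simple). [cite: AuslanderReitenSmalo1995, I Thm. 1.2 and p. 9] -/
theorem IsSemisimple.finrank_hom_left_eq_finrank_hom_right (hH : H.IsSemisimple) (hC : C.IsSimple) :
    finrank ℚ ((MixedHodgeStructure.hom C H).hodgeClasses 0) = finrank ℚ ((MixedHodgeStructure.hom H C).hodgeClasses 0) := by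
  rw [hH.finrank_hom_left_eq_multiplicity_mul hC, hH.finrank_hom_right_eq_multiplicity_mul hC]

end Semisimple

/-! ### §4 Arbitrary `H`: the socle governs maps in, the top `H / rad H` governs maps out -/

section General

variable {V : Type u} [AddCommGroup V] [Module ℚ V] [FiniteDimensional ℚ V]
variable {VC : Type uc} [AddCommGroup VC] [Module ℚ VC] [FiniteDimensional ℚ VC] {C : MixedHodgeStructure VC}

omit [FiniteDimensional ℚ VC] in
/-- A morphism from a simple MHS lands in the socle (its image is `0` or simple). [cite: CattaniElZeinGriffithsLe2014, p. 270] -/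
theorem IsSimple.range_le_socle {H : MixedHodgeStructure V} (hC : C.IsSimple) (f : Hom C H) :
    LinearMap.range f.toLinearMap ≤ (socle H).toSubmodule := by
  by_cases hf : f = Hom.zero C H
  · rw [hf, Hom.zero_toLinearMap, LinearMap.range_zero]; exact bot_le
  · rw [← Hom.range_toSubmodule]
    exact le_socle_of_isSimple f.range (hC.range hf)

/-- **`dim Hom_MHS(C, H) = dim Hom_MHS(C, soc H)` for simple `C`.** [cite: CattaniElZeinGriffithsLe2014, p. 270]
[cite: Jannsen1990MixedMotives, 7.8 (p. 94)] -/
theorem finrank_hom_left_eq_socle (H : MixedHodgeStructure V) (hC : C.IsSimple) :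
    finrank ℚ ((hom C H).hodgeClasses 0) = finrank ℚ ((hom C (socle H).toMixedHodgeStructure).hodgeClasses 0) :=
  finrank_hom_left_eq_of_forall_range_le C (socle H) fun f => hC.range_le_socle f

/-- **`dim_ℚ Hom_MHS(C, H) = [soc H : C] · dim_ℚ End_MHS(C)`** for every MHS `H` and simple `C`.
[cite: AuslanderReitenSmalo1995, I Thm. 1.2 and p. 9] [cite: Jannsen1990MixedMotives, 7.8 (p. 94)] -/
theorem finrank_hom_left_eq_multiplicity_socle_mul (H : MixedHodgeStructure V) (hC : C.IsSimple) :
    finrank ℚ ((hom C H).hodgeClasses 0) =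
      (socle H).toMixedHodgeStructure.multiplicity C * finrank ℚ ((hom C C).hodgeClasses 0) := by
  rw [finrank_hom_left_eq_socle H hC]
  exact (isSemisimple_socle H).finrank_hom_left_eq_multiplicity_mul hC

/-- Hence `dim_ℚ Hom_MHS(C, H) ≤ [H : C] · dim_ℚ End_MHS(C)` (`[soc H : C] ≤ [H : C]`). [cite: Krause2021, §13.1, Lemma 13.1.5]
[cite: Jannsen1990MixedMotives, 7.8 (p. 94)] -/
theorem finrank_hom_left_le_multiplicity_mul (H : MixedHodgeStructure V) (hC : C.IsSimple) :
    finrank ℚ ((hom C H).hodgeClasses 0) ≤ H.multiplicity C * finrank ℚ ((hom C C).hodgeClasses 0) := by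
  rw [finrank_hom_left_eq_multiplicity_socle_mul H hC]
  exact Nat.mul_le_mul_right _ ((socle H).multiplicity_toMixedHodgeStructure_le C)

/-- **`dim Hom_MHS(H, C) = dim Hom_MHS(H / rad H, C)` for simple `C`** (morphisms to a semisimple MHS kill `rad H`).
[cite: CattaniElZeinGriffithsLe2014, Thm. 3.2.18 and p. 270] [cite: Jannsen1990MixedMotives, 7.8 (p. 94)] -/
theorem finrank_hom_right_eq_radical_quotient (H : MixedHodgeStructure V) (hC : C.IsSimple) :
    finrank ℚ ((hom H C).hodgeClasses 0) = finrank ℚ ((hom (radical H).quotient C).hodgeClasses 0) :=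
  finrank_hom_right_eq_of_forall_le_ker C (radical H) fun f => hC.isSemisimple.radical_le_ker f

/-- **`dim_ℚ Hom_MHS(H, C) = [H/rad H : C] · dim_ℚ End_MHS(C)`** for every MHS `H` and simple `C`.
[cite: AuslanderReitenSmalo1995, I Thm. 1.2 and p. 9] [cite: Jannsen1990MixedMotives, 7.8 (p. 94)] -/
theorem finrank_hom_right_eq_multiplicity_radical_quotient_mul (H : MixedHodgeStructure V) (hC : C.IsSimple) :
    finrank ℚ ((hom H C).hodgeClasses 0) =
      (radical H).quotient.multiplicity C * finrank ℚ ((hom C C).hodgeClasses 0) := by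
  rw [finrank_hom_right_eq_radical_quotient H hC]
  exact (isSemisimple_quotient_radical (H := H)).finrank_hom_right_eq_multiplicity_mul hC

/-- Hence `dim_ℚ Hom_MHS(H, C) ≤ [H : C] · dim_ℚ End_MHS(C)` with defect `[rad H : C] · dim End(C)`.
[cite: Krause2021, §13.1, Lemma 13.1.5] [cite: Jannsen1990MixedMotives, 7.8 (p. 94)] -/
theorem finrank_hom_right_add_eq_multiplicity_mul (H : MixedHodgeStructure V) (hC : C.IsSimple) :
    finrank ℚ ((hom H C).hodgeClasses 0) + (radical H).toMixedHodgeStructure.multiplicity C * finrank ℚ ((hom C C).hodgeClasses 0) =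
      H.multiplicity C * finrank ℚ ((hom C C).hodgeClasses 0) := by
  rw [finrank_hom_right_eq_multiplicity_radical_quotient_mul H hC, ← add_mul, add_comm, (radical H).multiplicity_add C]

/-- Dually `dim_ℚ Hom_MHS(C, H) + [H/soc H : C] · dim End(C) = [H : C] · dim End(C)`. [cite: Jannsen1990MixedMotives, 7.8 (p. 94)] -/
theorem finrank_hom_left_add_eq_multiplicity_mul (H : MixedHodgeStructure V) (hC : C.IsSimple) :
    finrank ℚ ((hom C H).hodgeClasses 0) + (socle H).quotient.multiplicity C * finrank ℚ ((hom C C).hodgeClasses 0) =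
      H.multiplicity C * finrank ℚ ((hom C C).hodgeClasses 0) := by
  rw [finrank_hom_left_eq_multiplicity_socle_mul H hC, ← add_mul, (socle H).multiplicity_add C]

/-- For a semisimple `H` both defects vanish: `dim Hom(C, H) = dim Hom(H, C) = [H : C] · d_C` (restated).
[cite: Jannsen1990MixedMotives, 7.8 b) (p. 94)] -/
theorem IsSemisimple.finrank_hom_right_eq_of_isSimple {H : MixedHodgeStructure V} (hH : H.IsSemisimple) (hC : C.IsSimple) :
    finrank ℚ ((MixedHodgeStructure.hom H C).hodgeClasses 0) = H.multiplicity C * finrank ℚ ((MixedHodgeStructure.hom C C).hodgeClasses 0) :=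
  hH.finrank_hom_right_eq_multiplicity_mul hC

end General

/-! ### §5 `C = ℚ(-p)`: co-Hodge classes -/

section Tate

variable {V : Type u} [AddCommGroup V] [Module ℚ V] [FiniteDimensional ℚ V]

/-- **`dim_ℚ End_MHS(ℚ(j)) = 1`** (`End_MHS(ℚ(j)) = ℚ`). [cite: DeligneHodgeII1971, 2.1.13 and 1.1.12]
[cite: CattaniElZeinGriffithsLe2014, p. 270] -/
theorem finrank_hom_tate_tate (j : ℤ) :
    finrank ℚ ((hom (HodgeStructure.tate j).toMixedHodgeStructure (HodgeStructure.tate j).toMixedHodgeStructure).hodgeClasses 0) = 1 := by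
  refine le_antisymm ?_ ?_
  · refine (Submodule.finrank_le _).trans ?_
    rw [Module.finrank_linearMap, Module.finrank_self]
  · rw [Nat.one_le_iff_ne_zero, Ne, ← forall_hom_eq_zero_iff_finrank_eq_zero]
    intro h
    have h1 := congrArg (fun f : Hom _ _ => f.toLinearMap (1 : ℚ)) (h (Hom.id _))
    simp only [Hom.id_toLinearMap, LinearMap.id_apply, Hom.zero_toLinearMap, LinearMap.zero_apply] at h1
    exact one_ne_zero h1

/-- **The co-Hodge classes: `dim_ℚ Hom_MHS(H, ℚ(-p)) = [H/rad H : ℚ(-p)]`** — morphisms to `ℚ(-p)` are governed by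
the top of `H`, dually to `dim_ℚ Hdgᵖ(H) = [soc H : ℚ(-p)]`. [cite: Jannsen1990MixedMotives, 7.8 (p. 94)]
[cite: AuslanderReitenSmalo1995, I Thm. 1.2 and p. 9] -/
theorem finrank_hom_tate_eq_multiplicity_radical_quotient (H : MixedHodgeStructure V) (p : ℤ) :
    finrank ℚ ((hom H (HodgeStructure.tate (-p)).toMixedHodgeStructure).hodgeClasses 0) =
      (radical H).quotient.multiplicity (HodgeStructure.tate (-p)).toMixedHodgeStructure := by
  rw [finrank_hom_right_eq_multiplicity_radical_quotient_mul H (isSimple_tate (-p)), finrank_hom_tate_tate, mul_one]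

/-- `dim_ℚ Hom_MHS(H, ℚ(-p)) ≤ [H : ℚ(-p)]`, with defect `[rad H : ℚ(-p)]`. [cite: Jannsen1990MixedMotives, 7.8 (p. 94)] -/
theorem finrank_hom_tate_add_multiplicity_radical (H : MixedHodgeStructure V) (p : ℤ) :
    finrank ℚ ((hom H (HodgeStructure.tate (-p)).toMixedHodgeStructure).hodgeClasses 0) +
        (radical H).toMixedHodgeStructure.multiplicity (HodgeStructure.tate (-p)).toMixedHodgeStructure =
      H.multiplicity (HodgeStructure.tate (-p)).toMixedHodgeStructure := by
  have h := finrank_hom_right_add_eq_multiplicity_mul H (C := (HodgeStructure.tate (-p)).toMixedHodgeStructure)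
    (isSimple_tate (-p))
  rwa [finrank_hom_tate_tate, mul_one, mul_one] at h

/-- `dim_ℚ Hom_MHS(H, ℚ(-p)) ≤ [H : ℚ(-p)]`. [cite: Jannsen1990MixedMotives, 7.8 (p. 94)] -/
theorem finrank_hom_tate_le_multiplicity (H : MixedHodgeStructure V) (p : ℤ) :
    finrank ℚ ((hom H (HodgeStructure.tate (-p)).toMixedHodgeStructure).hodgeClasses 0) ≤
      H.multiplicity (HodgeStructure.tate (-p)).toMixedHodgeStructure := by
  rw [← finrank_hom_tate_add_multiplicity_radical H p]
  exact Nat.le_add_right _ _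

/-- **For a semisimple `H`: `dim_ℚ Hom_MHS(H, ℚ(-p)) = [H : ℚ(-p)] = dim_ℚ Hdgᵖ(H)`.** [cite: Jannsen1990MixedMotives, 7.8 b) (p. 94)] -/
theorem IsSemisimple.finrank_hom_tate_eq_multiplicity {H : MixedHodgeStructure V} (hH : H.IsSemisimple) (p : ℤ) :
    finrank ℚ ((MixedHodgeStructure.hom H (HodgeStructure.tate (-p)).toMixedHodgeStructure).hodgeClasses 0) =
      H.multiplicity (HodgeStructure.tate (-p)).toMixedHodgeStructure := by
  rw [hH.finrank_hom_right_eq_multiplicity_mul (isSimple_tate (-p)), finrank_hom_tate_tate, mul_one]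

/-- For a semisimple `H`, `Hdgᵖ(H)` and the co-Hodge classes `Hom_MHS(H, ℚ(-p))` have the same dimension.
[cite: Jannsen1990MixedMotives, 7.8 b) (p. 94)] -/
theorem IsSemisimple.finrank_hom_tate_eq_finrank_hodgeClasses {H : MixedHodgeStructure V} (hH : H.IsSemisimple) (p : ℤ) :
    finrank ℚ ((MixedHodgeStructure.hom H (HodgeStructure.tate (-p)).toMixedHodgeStructure).hodgeClasses 0) = finrank ℚ (H.hodgeClasses p) := by
  rw [hH.finrank_hom_tate_eq_multiplicity, hH.finrank_hodgeClasses_eq_multiplicity]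

/-- Consistency with `MixedHodgeStructureHodgeClassesMultiplicity`: **`dim_ℚ Hom_MHS(ℚ(-p), H) = [soc H : ℚ(-p)]
= dim_ℚ Hdgᵖ(H)`**. [cite: Jannsen1990MixedMotives, 7.8 (p. 94)] [cite: Arapura2022, §1 (p. 3)] -/
theorem finrank_tate_hom_eq_finrank_hodgeClasses (H : MixedHodgeStructure V) (p : ℤ) :
    finrank ℚ ((hom (HodgeStructure.tate (-p)).toMixedHodgeStructure H).hodgeClasses 0) = finrank ℚ (H.hodgeClasses p) := by
  rw [finrank_hom_left_eq_multiplicity_socle_mul H (isSimple_tate (-p)), finrank_hom_tate_tate, mul_one,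
    finrank_hodgeClasses_eq_multiplicity_socle]

end Tate

end MixedHodgeStructure

end Literature.AlgebraicGeometry.Motives
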